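import Summits.BirchSwinnertonDyer.BirchSwinnertonDyer.Theorems.GenusKolyvaginAtTwoPowDvdShaCardAtTwoPosTExactEigenFunctionalLawTransposition
import Summits.BirchSwinnertonDyer.BirchSwinnertonDyer.Theorems.KolyvaginRankRigidityAtTwoSwapPairingLowerBoundGlobal
import Summits.BirchSwinnertonDyer.BirchSwinnertonDyer.Theorems.KolyvaginRankRigidityAtTwoRegularRefillAtKolyvaginPlace
import Summits.BirchSwinnertonDyer.Rank1Residual.JET.TransverseFamilyConjAct
import HarnessLib

/-!
# Route `GenusKolyvaginAtTwo`, crux L⁺_T `PowDvdShaCardAtTwoPosT` (stmt-BirchSwinnertonDyer-23379), road (E4)⁺, socket swap⁺ —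
# P7b⁼ AT A TRANSPOSITION-DEEP PRIME, SIGN-FREE IN `Δ`: the EXACT transverse-side upper bound of the swap pairing at the prime swapped out
# (`2^(a₀+b₀−M−1) • ⟨loc_v w, loc_v (w_* C)⟩_v = 0`) — gk2-p3 g23's `…RTExactSwapLawTransverse` with `Δ < 0 ∧ FrobEqFrobInfty` ↦ the transposition clause

Seat `bsd-line-gk2-p5` g32 (WIDTH-5 attach, cell `bsd-f1-sign2`), `--supports stmt-BirchSwinnertonDyer-23379` (helper; closes nothing).
THEOREMS ONLY (no definition, no named fact, no `sorry`).  BSD is NOT proved by any of this; neither is L⁺_T nor any stub.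

WHAT.  `swapPairing_pow_smul_eq_zero_at_two_exact_of_transposition` — the socket `hP7b` of LEAD g18's `PlusDescent.exactSwap_core`
(`…RTExactSwapCore(Frob)`) in its EXACT form on the HYBRID transverse structure (gk2-p3 g23, `…RTExactSwapLawTransverse`), re-cut for the
`Δ > 0` port of the swap (LEAD gk2-p1 g20 memo R10 §0.3 «swap⁺», ruling R10′): the frame binder `(hΔ : W.Δ < 0)` is DELETED and, in the
displayed law, the regularity binder of the swapped-out prime `M ≤ M' → FrobEqFrobInfty W K (2 ^ M') q →` is REPLACED by the transposition
clause `(∃ v 𝔓 h, (q : 𝓞 ℚ) ∈ v.asIdeal ∧ 𝔓 ∈ v.primesAbove ∧ IsArithFrobAt (𝓞 ℚ) h 𝔓 ∧ ∃ u : E[2], h • u ≠ u) →`.  gk2-p3's warning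
stands and is exactly respected: the extra bit is FALSE at a Zhang–Kolyvagin prime with `Frob = diag(1, −1)` on `E[2^{M+1}]` — such a Frobenius
FIXES `E[2]` pointwise, so it is excluded by the transposition clause, which is the sign-free form of «regular» (`E[2^M]` free of rank one over
`ℤ/2^M[Frob]`, gk2-p2 g22 `exists_regular_frame_liftAutPlace_of_transposition`).  Statement otherwise VERBATIM (frame `d_K < −4`, `τ ≠ 1`,
`τ² = 1`, `hτe`, `hperf`, `hinvc`, hybrid `hTko`); proof verbatim (`Kum_v ⊕ 𝒯_v`, KRR `RegularRefill`, isotropy, `σ_*`-stability, KRR's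
functional bookkeeping) with the last step the sign-free exact local Kummer law `kummer_eigenFunctional_pow_smul_eq_zero_at_two_of_transposition`.

References: [Kolyvagin1991MathAnn] §2 (proof of Thm. 2.2); [MazurRubin2004] Lemma 1.2.4, Prop. 1.3.2 (ii); [McCallumLMS1991] §5 (13);
[GrossLMS1991] §3 (3.2)–(3.3); [Jetchev2008] §3.2.
-/

set_option autoImplicit false
-- the Theorems namespace of this sub repeats the summit name by design (D-0017 nested layout)
set_option linter.dupNamespace false

noncomputable section

open scoped Classical
open Function NumberField IsDedekindDomain WeierstrassCurve Field
open Literature.NumberTheory.EllipticCurves Literature.NumberTheory.EllipticCurves.Jetchev2008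
open Literature.NumberTheory.GaloisRepresentations Literature.NumberTheory.GaloisCohomology
open Literature.NumberTheory.GaloisRepresentations.DiscreteGaloisModule (localTatePairingZMod tateDual transverseSubgroup
  SelmerStructure)
open Literature.NumberTheory.Automorphic
open Summit.BirchSwinnertonDyer.Rank1Residual
open Summit.BirchSwinnertonDyer.Rank1Residual.JET.GlobalDuality
open Summit.BirchSwinnertonDyer.Rank1Residual.JET.SelmerVocabulary
open Summit.BirchSwinnertonDyer.Rank1Residual.X11b.Relaxation (invWeilPairing invWeilPairing_apply)
open Summit.BirchSwinnertonDyer.BirchSwinnertonDyer.Theorems.KolyvaginLowerBoundAtTwo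
open Summit.BirchSwinnertonDyer.BirchSwinnertonDyer.Theorems.KolyvaginAtTwo

namespace Summit.BirchSwinnertonDyer.BirchSwinnertonDyer.Theorems.GenusExact.PlusDescent

variable {K : Type} [Field K] [NumberField K] (W : WeierstrassCurve ℚ) [W.IsElliptic]
  [W.IsGloballyMinimal] [(W.baseChange K).IsElliptic]
  [∀ M : ℕ, NeZero (2 ^ M)] [∀ M : ℕ, Finite (geomTorsion (W.baseChange K) ((2 ^ M : ℕ) : ℤ))]
  (τ : K ≃ₐ[ℚ] K) (ι : K →+* ℂ) [∀ j : ℕ, NumberField (ringClassField K ι j)]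
  (e : ∀ M : ℕ, geomTorsion (W.baseChange K) ((2 ^ M : ℕ) : ℤ) →
    geomTorsion (W.baseChange K) ((2 ^ M : ℕ) : ℤ) → AlgebraicClosure K)
  (hμ : ∀ M S T, e M S T ^ (2 ^ M) = 1)
  (hadd₁ : ∀ M S₁ S₂ T, e M (S₁ + S₂) T = e M S₁ T * e M S₂ T)
  (hadd₂ : ∀ M S T₁ T₂, e M S (T₁ + T₂) = e M S T₁ * e M S T₂)
  (hgal : ∀ M (g : absoluteGaloisGroup K) (S T : geomTorsion (W.baseChange K) ((2 ^ M : ℕ) : ℤ)),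
    g • e M S T = e M (g • S) (g • T))
  (halt : ∀ M T, e M T T = 1) (hnondeg : ∀ M T, (∀ S, e M S T = 1) → T = 0)
  (inv : ∀ M : ℕ, LocalInvariants K (2 ^ M))
  (𝒯 : ∀ M : ℕ, SelmerStructure ((W.baseChange K).torsionGaloisModule ((2 ^ M : ℕ) : ℤ)))

include halt hnondeg in
/-- **SOCKET `hP7b` of the exact swap, EXACT, at a TRANSPOSITION-deep swapped-out prime (any sign of `Δ`).**  At the place `v` of the
Kolyvagin prime `q` (index `≥ M + 1`) being swapped out, some arithmetic Frobenius above which moves a point of `E[2]`: for global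
`s`-eigenclasses `w`, `C` with `loc_v C ∈ 𝒯_v`, `2^{a₀} loc_v w ∈ 𝒯_v`, `2^{b₀} loc_v C = 0` (hybrid `𝒯`: ring-class transverse at `v`),
`2^(a₀ + b₀ − M − 1) • ⟨loc_v w, loc_v (w_* C)⟩_v = 0`.  (= gk2-p3 g23's `swapPairing_pow_smul_eq_zero_at_two_exact` with `Δ < 0 ∧ FrobEqFrobInfty`
replaced by the transposition clause; proof adapted verbatim from `…RTExactSwapLawTransverse`.) [cite: Kolyvagin1991MathAnn, §2 (proof of Thm. 2.2)]
[cite: MazurRubin2004, Lemma 1.2.4, Prop. 1.3.2 (ii)] [cite: McCallumLMS1991, §5 (13)] [cite: GrossLMS1991, §3 (3.2)–(3.3)] -/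
theorem swapPairing_pow_smul_eq_zero_at_two_exact_of_transposition (hK : IsImaginaryQuadratic K)
    (hD : NumberField.discr K < -4) (hτ1 : τ ≠ 1) (hττ : τ * τ = 1)
    (hτe : ∀ (M : ℕ) S T, liftAut τ (e M S T) =
      e M ((isLiftOfAut_liftAut τ).torsionMap W ((2 ^ M : ℕ) : ℤ) S)
        ((isLiftOfAut_liftAut τ).torsionMap W ((2 ^ M : ℕ) : ℤ) T))
    (hperf : ∀ M : ℕ, (inv M).IsPerfect) (hinvc : ∀ M : ℕ, (inv M).IsConjCompatible τ)
    (hTko : ∀ (M : ℕ) (v : HeightOneSpectrum (𝓞 K)) (q : ℕ),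
      Zhang2014.IsKolyvaginPrime (W.conductorNorm ℤ) W K 2 q → M + 1 ≤ Zhang2014.kolyvaginIndex W 2 q →
      (q : 𝓞 K) ∈ v.asIdeal →
      𝒯 M (Sum.inr v) = ⨅ (w' : HeightOneSpectrum (𝓞 (ringClassField K ι q)))
          (_ : w'.asIdeal.LiesOver v.asIdeal),
          letI := (adicCompletionOfLiesOver K (ringClassField K ι q) v w').toAlgebra
          transverseSubgroup (GaloisRep.toLocal v ((W.baseChange K).torsionGaloisModule ((2 ^ M : ℕ) : ℤ)))
            (w'.adicCompletion (ringClassField K ι q))) :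
    ∀ (M q : ℕ) (v : HeightOneSpectrum (𝓞 K))
      (w C : galoisCohomology ((W.baseChange K).torsionGaloisModule ((2 ^ M : ℕ) : ℤ)) 1) (s : ℤ) (a₀ b₀ : ℕ),
      (s = 1 ∨ s = -1) → Zhang2014.IsKolyvaginPrime (W.conductorNorm ℤ) W K 2 q →
      M + 1 ≤ Zhang2014.kolyvaginIndex W 2 q →
      (∃ (v₁ : HeightOneSpectrum (𝓞 ℚ)) (𝔓 : Ideal (absIntegers (𝓞 ℚ) ℚ)) (h : absoluteGaloisGroup ℚ),
        (q : 𝓞 ℚ) ∈ v₁.asIdeal ∧ 𝔓 ∈ v₁.primesAbove ∧ IsArithFrobAt (𝓞 ℚ) h 𝔓 ∧ ∃ u : geomTorsion W 2, h • u ≠ u) →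
      ((q : ℕ) : 𝓞 K) ∈ v.asIdeal →
      conjAct W τ ((2 ^ M : ℕ) : ℤ) w = s • w → conjAct W τ ((2 ^ M : ℕ) : ℤ) C = s • C →
      galoisCohomology.localization ((W.baseChange K).torsionGaloisModule ((2 ^ M : ℕ) : ℤ)) (Sum.inr v) 1 C ∈
        𝒯 M (Sum.inr v) →
      ((2 ^ a₀ : ℕ) : ℤ) • galoisCohomology.localization ((W.baseChange K).torsionGaloisModule ((2 ^ M : ℕ) : ℤ))
        (Sum.inr v) 1 w ∈ 𝒯 M (Sum.inr v) →
      ((2 ^ b₀ : ℕ) : ℤ) • galoisCohomology.localization ((W.baseChange K).torsionGaloisModule ((2 ^ M : ℕ) : ℤ))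
        (Sum.inr v) 1 C = 0 →
      (2 ^ (a₀ + b₀ - M - 1) : ℕ) •
          localTatePairingZMod ((W.baseChange K).torsionGaloisModule ((2 ^ M : ℕ) : ℤ)) (2 ^ M) (Sum.inr v)
            (inv M (Sum.inr v))
            (galoisCohomology.localization ((W.baseChange K).torsionGaloisModule ((2 ^ M : ℕ) : ℤ)) (Sum.inr v) 1 w)
            (galoisCohomology.localization (((W.baseChange K).torsionGaloisModule ((2 ^ M : ℕ) : ℤ)).tateDual (2 ^ M))
              (Sum.inr v) 1
              (galoisCohomology.map (weilDualIntertwining (W.baseChange K) (2 ^ M) (e M) (hμ M) (hadd₁ M) (hadd₂ M)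
                (hgal M)) 1 C)) = 0 := by
  intro M q v w C s a₀ b₀ hs hq hMq hR hv hwτ hCτ hCT hwT hC0
  classical
  haveI : Fact (Nat.Prime 2) := ⟨Nat.prime_two⟩
  haveI : CharZero (v.adicCompletion K) :=
    charZero_of_injective_algebraMap (algebraMap K (v.adicCompletion K)).injective
  haveI : CompactSpace (absoluteGaloisGroup (Place.Completion (Sum.inr v : Place K))) := absoluteGaloisGroup_compactSpace _
  have hq0 : q ≠ 0 := hq.1.ne_zero
  have hfix : τ • v = v := smul_place_eq_self_of_natCast_mem τ hq0 hq.2.2.2.2.1 v hv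
  have hMq' : M ≤ Zhang2014.kolyvaginIndex W 2 q := Nat.le_of_succ_le hMq
  have hvq : v ∈ placesDividing K q := (mem_placesDividing_iff_natCast_mem hq0 v).mpr hv
  have e2 : ∀ n : ℕ, ((2 ^ n : ℕ) : ℤ) = (2 : ℤ) ^ n := fun n ↦ by norm_num
  -- the values are killed by `2^M`
  have hC : ∀ c : ZMod (2 ^ M), (2 : ℤ) ^ M • c = 0 := fun c ↦ by
    rw [← e2, natCast_zsmul, nsmul_eq_mul, ZMod.natCast_self, zero_mul]
  set P := localTatePairingZMod ((W.baseChange K).torsionGaloisModule ((2 ^ M : ℕ) : ℤ)) (2 ^ M)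
      (Sum.inr v : Place K) (inv M (Sum.inr v)) with hP
  set x := galoisCohomology.localization ((W.baseChange K).torsionGaloisModule ((2 ^ M : ℕ) : ℤ)) (Sum.inr v) 1 w
    with hxdef
  set y := galoisCohomology.localization
      (((W.baseChange K).torsionGaloisModule ((2 ^ M : ℕ) : ℤ)).tateDual (2 ^ M)) (Sum.inr v) 1
      (galoisCohomology.map (weilDualIntertwining (W.baseChange K) (2 ^ M) (e M) (hμ M) (hadd₁ M) (hadd₂ M)
        (hgal M)) 1 C) with hy
  -- `M = 0`: everything vanishes
  rcases Nat.eq_zero_or_pos M with h0 | hM1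
  · have h := hC (P x y)
    have h1 : (2 : ℤ) ^ M = 1 := by rw [h0, pow_zero]
    rw [h1, one_zsmul] at h
    rw [h, smul_zero]
  -- ### the conductor-`q` transverse structure (KRR `RegularRefill` currency) and its identification with `𝒯 M` at `v`
  obtain ⟨𝒯q, h𝒯q⟩ : ∃ 𝒯q : SelmerStructure ((W.baseChange K).torsionGaloisModule ((2 ^ M : ℕ) : ℤ)),
      ∀ v' : HeightOneSpectrum (𝓞 K), 𝒯q (Sum.inr v') =
        ⨅ ℓ ∈ q.primeFactors.filter (fun ℓ : ℕ ↦ ((ℓ : ℕ) : 𝓞 K) ∈ v'.asIdeal),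
          ⨅ (w' : HeightOneSpectrum (𝓞 (ringClassField K ι ℓ))) (_ : w'.asIdeal.LiesOver v'.asIdeal),
            letI := (adicCompletionOfLiesOver K (ringClassField K ι ℓ) v' w').toAlgebra
            transverseSubgroup (GaloisRep.toLocal v' ((W.baseChange K).torsionGaloisModule ((2 ^ M : ℕ) : ℤ)))
              (w'.adicCompletion (ringClassField K ι ℓ)) :=
    ⟨fun p ↦ match p with
      | Sum.inl _ => ⊤
      | Sum.inr v' => ⨅ ℓ ∈ q.primeFactors.filter (fun ℓ : ℕ ↦ ((ℓ : ℕ) : 𝓞 K) ∈ v'.asIdeal),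
          ⨅ (w' : HeightOneSpectrum (𝓞 (ringClassField K ι ℓ))) (_ : w'.asIdeal.LiesOver v'.asIdeal),
            letI := (adicCompletionOfLiesOver K (ringClassField K ι ℓ) v' w').toAlgebra
            transverseSubgroup (GaloisRep.toLocal v' ((W.baseChange K).torsionGaloisModule ((2 ^ M : ℕ) : ℤ)))
              (w'.adicCompletion (ringClassField K ι ℓ)),
      fun _ ↦ rfl⟩
  have hqpf : ∀ ℓ : ℕ, ℓ ∈ q.primeFactors → ℓ = q := fun ℓ hℓ ↦ by
    obtain ⟨hℓp, hℓq, -⟩ := Nat.mem_primeFactors.mp hℓ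
    exact (Nat.prime_dvd_prime_iff_eq hℓp hq.1).mp hℓq
  have hTq : 𝒯 M (Sum.inr v) = 𝒯q (Sum.inr v) := by
    rw [hTko M v q hq hMq hv, h𝒯q v]
    ext z
    simp only [AddSubgroup.mem_iInf, Finset.mem_filter]
    constructor
    · intro hz ℓ hℓ w' hw'
      obtain rfl := hqpf ℓ hℓ.1
      exact hz w' hw'
    · intro hz w' hw'
      exact hz q ⟨Nat.mem_primeFactors.mpr ⟨hq.1, dvd_rfl, hq0⟩, hv⟩ w' hw'
  rw [hTq] at hCT hwT
  have hkol : ∀ ℓ ∈ q.primeFactors, Zhang2014.IsKolyvaginPrime (W.conductorNorm ℤ) W K 2 ℓ := fun ℓ hℓ ↦ by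
    rw [hqpf ℓ hℓ]; exact hq
  have hkM : ∀ ℓ ∈ q.primeFactors, M + 1 ≤ Zhang2014.kolyvaginIndex W 2 ℓ := fun ℓ hℓ ↦ by
    rw [hqpf ℓ hℓ]; exact hMq
  -- `Kum_v ⊓ 𝒯_v = ⊥`, `Kum_v ⊔ 𝒯_v = ⊤`, `𝒯_v` isotropic and `σ_*`-stable
  have hinf := RegularRefill.kummer_inf_transverse_eq_bot_two W M hK hD ι hM1 q hq.1.squarefree hkol hkM 𝒯q h𝒯q v hvq
  have hsup := RegularRefill.kummer_sup_transverse_eq_top_two W M hK hD ι hM1 q hq.1.squarefree hkol hkM 𝒯q h𝒯q v hvq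
  have hdisj : ∀ z, z ∈ (W.baseChange K).kummerSelmerStructure ((2 ^ M : ℕ) : ℤ) (Sum.inr v : Place K) →
      z ∈ 𝒯q (Sum.inr v) → z = 0 :=
    fun z hzK hzT ↦ (AddSubgroup.eq_bot_iff_forall _).mp hinf z (AddSubgroup.mem_inf.mpr ⟨hzK, hzT⟩)
  have hiso : ∀ z₁ ∈ 𝒯q (Sum.inr v), ∀ z₂ ∈ 𝒯q (Sum.inr v),
      invWeilPairing (W.baseChange K) (2 ^ M) (e M) (hμ M) (hadd₁ M) (hadd₂ M) (hgal M) (inv M) (Sum.inr v) z₁ z₂ = 0 :=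
    fun z₁ hz₁ z₂ hz₂ ↦ RegularRefill.transverse_isotropic_two W M (e M) (hμ M) (hadd₁ M) (hadd₂ M) (hgal M) (halt M)
      (hnondeg M) (inv M) hK hD ι hM1 q hq.1.squarefree hkol hkM 𝒯q h𝒯q (hperf M) v hvq hz₁ hz₂
  have hTσ : ∀ z ∈ 𝒯q (Sum.inr v), conjActPlace W τ ((2 ^ M : ℕ) : ℤ) hfix z ∈ 𝒯q (Sum.inr v) :=
    fun z hz ↦ JET.forall_conjActPlace_mem_of_eq_iInf_transverseSubgroup W hK ι τ ((2 ^ M : ℕ) : ℤ) q 𝒯q h𝒯q v v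
      hfix hvq z hz
  -- ### the decomposition `loc_v w = u + t`
  have hxtop : x ∈ (W.baseChange K).kummerSelmerStructure ((2 ^ M : ℕ) : ℤ) (Sum.inr v : Place K) ⊔ 𝒯q (Sum.inr v) := by
    rw [hsup]; exact AddSubgroup.mem_top x
  obtain ⟨u, huK, t, htT, hut⟩ := AddSubgroup.mem_sup.mp hxtop
  set σ := conjActPlace W τ ((2 ^ M : ℕ) : ℤ) hfix with hσdef
  -- `u` is an `s`-eigenclass
  have hσx : σ x = s • x := by rw [hxdef, conjActPlace_localization, hwτ, map_zsmul]
  have hsum : (σ u - s • u) + (σ t - s • t) = 0 := by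
    have h1 : σ u + σ t = s • u + s • t := by rw [← map_add, ← smul_add, hut, hσx]
    rw [show (σ u - s • u) + (σ t - s • t) = (σ u + σ t) - (s • u + s • t) by abel, h1, sub_self]
  have hu : σ u = s • u := by
    have hmK : σ u - s • u ∈ (W.baseChange K).kummerSelmerStructure ((2 ^ M : ℕ) : ℤ) (Sum.inr v : Place K) :=
      sub_mem (conjActPlace_mem_kummerSelmerStructure W τ ((2 ^ M : ℕ) : ℤ) hfix huK) (AddSubgroup.zsmul_mem _ huK s)
    have hmT : σ u - s • u ∈ 𝒯q (Sum.inr v) := by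
      rw [eq_neg_of_add_eq_zero_left hsum]
      exact neg_mem (sub_mem (hTσ t htT) (AddSubgroup.zsmul_mem _ htT s))
    exact sub_eq_zero.mp (hdisj _ hmK hmT)
  -- `2^{a₀} u = 0`
  have hi : (2 : ℤ) ^ a₀ • u = 0 := by
    rw [← e2]
    apply hdisj _ (AddSubgroup.zsmul_mem _ huK _)
    have h1 : ((2 ^ a₀ : ℕ) : ℤ) • u = ((2 ^ a₀ : ℕ) : ℤ) • x - ((2 ^ a₀ : ℕ) : ℤ) • t := by
      rw [← hut, smul_add, add_sub_cancel_right]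
    rw [h1]
    exact sub_mem hwT (AddSubgroup.zsmul_mem _ htT _)
  -- ### the `s`-eigen functional `Φ = ⟨·, y⟩_v` (KRR's bookkeeping, as in `…RTExactSwapLawKummer`)
  have hyτ : conjActPlaceDual W τ ((2 ^ M : ℕ) : ℤ) (2 ^ M) hfix y = s • y := by
    rw [hy, conjActPlaceDual_localization,
      ← map_weilDual_conjAct W τ (2 ^ M) (e M) (hμ M) (hadd₁ M) (hadd₂ M) (hgal M) (hτe M) C, hCτ,
      map_zsmul, map_zsmul]
  have hΦ : ∀ a' ∈ (W.baseChange K).kummerSelmerStructure ((2 ^ M : ℕ) : ℤ) (Sum.inr v : Place K),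
      P.flip y (conjActPlace W τ ((2 ^ M : ℕ) : ℤ) hfix a') = s • P.flip y a' := by
    intro a' _
    simp only [AddMonoidHom.flip_apply]
    have h1 := localTatePairingZMod_conjActPlace W τ ((2 ^ M : ℕ) : ℤ) (N := 2 ^ M) (inv M) (hinvc M) hfix
      (conjActPlace W τ ((2 ^ M : ℕ) : ℤ) hfix a') y
    rw [conjActPlace_conjActPlace W τ ((2 ^ M : ℕ) : ℤ) hττ hfix hfix a', hyτ, map_zsmul] at h1
    rw [hP]
    exact h1.symm
  -- `y` is the local Weil transport of `loc_v C`, so `2^{b₀} y = 0` and `2^{b₀} Φ = 0`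
  have hnat : galoisCohomology.map ((weilDualIntertwining (W.baseChange K) (2 ^ M) (e M) (hμ M) (hadd₁ M)
      (hadd₂ M) (hgal M)).restrictField (Place.Completion (Sum.inr v : Place K))) 1
      (galoisCohomology.localization ((W.baseChange K).torsionGaloisModule ((2 ^ M : ℕ) : ℤ))
        (Sum.inr v) 1 C) = y := by
    rw [hy]
    exact (galoisCohomology.res_map_one _ _ C).symm
  have hmap : galoisCohomology.map ((weilDualIntertwining (W.baseChange K) (2 ^ M) (e M) (hμ M) (hadd₁ M)
      (hadd₂ M) (hgal M)).restrictField (Place.Completion (Sum.inr v : Place K))) 1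
      (((2 ^ b₀ : ℕ) : ℤ) • galoisCohomology.localization ((W.baseChange K).torsionGaloisModule ((2 ^ M : ℕ) : ℤ))
        (Sum.inr v) 1 C) = ((2 ^ b₀ : ℕ) : ℤ) • y :=
    (map_zsmul (galoisCohomology.map ((weilDualIntertwining (W.baseChange K) (2 ^ M) (e M) (hμ M) (hadd₁ M)
      (hadd₂ M) (hgal M)).restrictField (Place.Completion (Sum.inr v : Place K))) 1) _ _).trans
      (congrArg (fun z ↦ ((2 ^ b₀ : ℕ) : ℤ) • z) hnat)
  have hy0 : (2 : ℤ) ^ b₀ • y = 0 := by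
    rw [← e2, ← hmap]
    exact (congrArg _ hC0).trans (map_zero _)
  have hj : ∀ a' ∈ (W.baseChange K).kummerSelmerStructure ((2 ^ M : ℕ) : ℤ) (Sum.inr v : Place K),
      (2 : ℤ) ^ b₀ • P.flip y a' = 0 := fun a' _ ↦ by
    rw [AddMonoidHom.flip_apply, ← map_zsmul (P a'), hy0, map_zero]
  -- ### the exact local law on the Kummer component
  have key := kummer_eigenFunctional_pow_smul_eq_zero_at_two_of_transposition W K hK hM1 hq hMq' hR v hv hτ1 hfix hs hC
    (P.flip y) hΦ huK hu hi hj
  -- ### `⟨x, y⟩ = ⟨u, y⟩`: the transverse component pairs trivially with the transverse class `loc_v C`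
  have hPt : P t y = 0 := by
    rw [hP, ← hnat, X11b.LocBridge.localTatePairingZMod_map_weilDual, ← invWeilPairing_apply]
    exact hiso t htT _ hCT
  have hPx : P x y = P.flip y u := by
    rw [AddMonoidHom.flip_apply, ← hut, map_add, AddMonoidHom.add_apply, hPt, add_zero]
  rw [hPx, ← natCast_zsmul, e2]
  exact key

end Summit.BirchSwinnertonDyer.BirchSwinnertonDyer.Theorems.GenusExact.PlusDescent

end
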